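import Mathlib
import HarnessLib

/-!
# Graded bookkeeping for the slice theorem: transport, images, coarsening, homogeneous units

Topic: `Summits/ResolutionOfSingularities/ResolutionOfSingularities/Theorems`. Helper file of the
stub `stub_quotientSingularities_of_regular` of the line `Sketch` of the crux
`Theses.WeightedInvariant.DatumToEmbedded` (statement `stmt-ResolutionOfSingularities-0572`).

Four pieces of folklore about a ring `A = ⨁ᵢ Aᵢ` graded by an additive monoid/group
(Mathlib `GradedRing` / `GradedAlgebra`, Bourbaki *Algèbre* II §11):

* `nonempty_gradedRing_of_mem_iff` — a grading only depends on the underlying family of SUBSETS: if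
  `ℬ i` and `𝒜 i` have the same elements (e.g. `ℬ i = (𝒜 i).restrictScalars k`, or the
  submodule with carrier an additive subgroup) then `ℬ` is a grading as soon as `𝒜` is;
* `exists_gradedRing_map` — the image grading along a SURJECTIVE ring map whose kernel is
  homogeneous (the grading of `A ⧸ I` by a homogeneous ideal, phrased for any quotient map);
* `nonempty_gradedAlgebra_coarsen` — coarsening the grading along an additive map of degrees
  `φ : ι → ι'`, `A_{j} := ⨁_{φ i = j} Aᵢ` (`coarsen`);
* `exists_inv_mem_of_isUnit` — in a ring graded by a GROUP the inverse of a homogeneous unit of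
  degree `i` is homogeneous of degree `-i`.

Only Mathlib is used; no definitions are published (the gradings are returned existentially).
-/

-- the summit namespace repeats `ResolutionOfSingularities` by design (mandated namespace)
set_option linter.dupNamespace false

namespace Summit.ResolutionOfSingularities.ResolutionOfSingularities.Theorems.DatumToEmbedded.QuotientSingularities

open DirectSum

/-! ## Homogeneous components of a sum of homogeneous elements -/

section DecomposeSum

variable {ι M σ : Type*} [DecidableEq ι] [AddCommMonoid M] [SetLike σ M] [AddSubmonoidClass σ M]
  (ℳ : ι → σ) [Decomposition ℳ]

/-- The `i`-th homogeneous component of `∑_{j ∈ s} gⱼ` with `gⱼ ∈ ℳ j` is `gᵢ` (or `0` if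
`i ∉ s`). [folklore] -/
theorem decompose_sum_of_mem (s : Finset ι) (g : ι → M) (hg : ∀ j ∈ s, g j ∈ ℳ j) (i : ι) :
    (decompose ℳ (∑ j ∈ s, g j) i : M) = if i ∈ s then g i else 0 := by
  rw [decompose_sum, DirectSum.sum_apply, AddSubmonoidClass.coe_finsetSum]
  split_ifs with hi
  · rw [Finset.sum_eq_single i, decompose_of_mem_same ℳ (hg i hi)]
    · exact fun j hj hji => decompose_of_mem_ne ℳ (hg j hj) hji
    · exact fun h => absurd hi h
  · exact Finset.sum_eq_zero fun j hj => decompose_of_mem_ne ℳ (hg j hj) fun h => hi (h ▸ hj)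

end DecomposeSum

/-! ## Transport of a grading along an equality of carriers -/

section Transport

variable {ι A σ σ' : Type*} [DecidableEq ι] [AddMonoid ι] [Semiring A]
  [SetLike σ A] [AddSubmonoidClass σ A] [SetLike σ' A] [AddSubmonoidClass σ' A]
  (𝒜 : ι → σ) (ℬ : ι → σ') (h : ∀ i x, x ∈ ℬ i ↔ x ∈ 𝒜 i)

include h in
omit [DecidableEq ι] [AddSubmonoidClass σ A] [AddSubmonoidClass σ' A] in
/-- Pieces with the same elements as a graded monoid form a graded monoid. [folklore] -/
theorem gradedMonoid_of_mem_iff [SetLike.GradedMonoid 𝒜] : SetLike.GradedMonoid ℬ where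
  one_mem := (h 0 1).2 (SetLike.one_mem_graded 𝒜)
  mul_mem _ _ _ _ hx hy := (h _ _).2 (SetLike.mul_mem_graded ((h _ _).1 hx) ((h _ _).1 hy))

/-- The componentwise identification `⨁ ℬ i →+ ⨁ 𝒜 i` of the two direct sums. [folklore] -/
def mapOfMemIff : (⨁ i, ℬ i) →+ ⨁ i, 𝒜 i :=
  DirectSum.map fun i =>
    { toFun := fun x => ⟨x.1, (h i x.1).1 x.2⟩
      map_zero' := rfl
      map_add' := fun _ _ => rfl }

/-- … and its inverse `⨁ 𝒜 i →+ ⨁ ℬ i`. [folklore] -/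
def mapOfMemIff' : (⨁ i, 𝒜 i) →+ ⨁ i, ℬ i :=
  DirectSum.map fun i =>
    { toFun := fun x => ⟨x.1, (h i x.1).2 x.2⟩
      map_zero' := rfl
      map_add' := fun _ _ => rfl }

omit [DecidableEq ι] [AddMonoid ι] in
/-- The two identifications are inverse to each other. [folklore] -/
theorem mapOfMemIff'_mapOfMemIff (x : ⨁ i, ℬ i) :
    mapOfMemIff' 𝒜 ℬ h (mapOfMemIff 𝒜 ℬ h x) = x := by
  refine DFinsupp.ext fun i => ?_
  simp [mapOfMemIff, mapOfMemIff', DirectSum.map_apply]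

omit [DecidableEq ι] [AddMonoid ι] in
/-- The two identifications are inverse to each other. [folklore] -/
theorem mapOfMemIff_mapOfMemIff' (x : ⨁ i, 𝒜 i) :
    mapOfMemIff 𝒜 ℬ h (mapOfMemIff' 𝒜 ℬ h x) = x := by
  refine DFinsupp.ext fun i => ?_
  simp [mapOfMemIff, mapOfMemIff', DirectSum.map_apply]

omit [AddMonoid ι] in
/-- The identification is compatible with the summation maps to `A`. [folklore] -/
theorem coeAddMonoidHom_comp_mapOfMemIff :
    (DirectSum.coeAddMonoidHom 𝒜).comp (mapOfMemIff 𝒜 ℬ h) = DirectSum.coeAddMonoidHom ℬ := by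
  refine DirectSum.addHom_ext fun i y => ?_
  simp [mapOfMemIff, DirectSum.map_of, DirectSum.coeAddMonoidHom_of]

include h in
omit [AddMonoid ι] in
/-- Pieces with the same elements as an internal direct-sum decomposition are an internal
direct-sum decomposition. [folklore] -/
theorem isInternal_of_mem_iff [Decomposition 𝒜] : DirectSum.IsInternal ℬ := by
  have hbij : Function.Bijective (DirectSum.coeAddMonoidHom 𝒜) := Decomposition.isInternal 𝒜
  have hcomp : ⇑(DirectSum.coeAddMonoidHom ℬ) =
      DirectSum.coeAddMonoidHom 𝒜 ∘ mapOfMemIff 𝒜 ℬ h := by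
    rw [← coeAddMonoidHom_comp_mapOfMemIff 𝒜 ℬ h]; rfl
  have hbij' : Function.Bijective (mapOfMemIff 𝒜 ℬ h) :=
    ⟨Function.LeftInverse.injective (mapOfMemIff'_mapOfMemIff 𝒜 ℬ h),
      Function.RightInverse.surjective (mapOfMemIff_mapOfMemIff' 𝒜 ℬ h)⟩
  change Function.Bijective (DirectSum.coeAddMonoidHom ℬ)
  rw [hcomp]
  exact hbij.comp hbij'

include h in
/-- **Transport of a grading along an equality of carriers**: if `x ∈ ℬ i ↔ x ∈ 𝒜 i` for all
`i, x` and `𝒜` is a grading of the ring `A`, so is `ℬ`. [folklore] -/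
theorem nonempty_gradedRing_of_mem_iff [GradedRing 𝒜] : Nonempty (GradedRing ℬ) :=
  haveI : SetLike.GradedMonoid ℬ := gradedMonoid_of_mem_iff 𝒜 ℬ h
  ⟨{ (inferInstance : SetLike.GradedMonoid ℬ) with
      toDecomposition := (isInternal_of_mem_iff 𝒜 ℬ h).chooseDecomposition }⟩

end Transport

/-! ## The image grading along a surjection with homogeneous kernel -/

section Image

variable {ι A B : Type*} [DecidableEq ι] [AddMonoid ι] [Ring A] [Ring B]
  (𝒜 : ι → AddSubgroup A) (f : A →+* B)

omit [DecidableEq ι] in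
/-- The images of the graded pieces form a graded monoid (for any ring map). [folklore] -/
theorem gradedMonoid_map [SetLike.GradedMonoid 𝒜] :
    SetLike.GradedMonoid fun i => (𝒜 i).map f.toAddMonoidHom where
  one_mem := ⟨1, SetLike.one_mem_graded 𝒜, map_one f⟩
  mul_mem := by
    rintro i j _ _ ⟨a, ha, rfl⟩ ⟨b, hb, rfl⟩
    exact ⟨a * b, SetLike.mul_mem_graded ha hb, map_mul f a b⟩

/-- The ring map on direct sums, componentwise. [folklore] -/
def mapPieces : (⨁ i, 𝒜 i) →+ ⨁ i, (𝒜 i).map f.toAddMonoidHom :=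
  DirectSum.map fun i =>
    { toFun := fun x => ⟨f x.1, AddSubgroup.mem_map_of_mem f.toAddMonoidHom x.2⟩
      map_zero' := Subtype.ext (by simp)
      map_add' := fun a b => Subtype.ext (by
        change f ((a : A) + b) = f a + f b
        exact map_add f _ _) }

omit [AddMonoid ι] in
/-- Summation commutes with the componentwise map. [folklore] -/
theorem coeAddMonoidHom_mapPieces (x : ⨁ i, 𝒜 i) :
    DirectSum.coeAddMonoidHom (fun i => (𝒜 i).map f.toAddMonoidHom) (mapPieces 𝒜 f x) =
      f (DirectSum.coeAddMonoidHom 𝒜 x) := by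
  rw [← AddMonoidHom.comp_apply, ← AddMonoidHom.coe_coe f, ← AddMonoidHom.comp_apply]
  congr 1
  refine DirectSum.addHom_ext fun i y => ?_
  rw [AddMonoidHom.comp_apply, AddMonoidHom.comp_apply, AddMonoidHom.coe_coe, mapPieces,
    DirectSum.map_of, DirectSum.coeAddMonoidHom_of, DirectSum.coeAddMonoidHom_of]
  rfl

/-- **The image grading.** Along a surjective ring map `f : A → B` whose kernel is homogeneous,
the images `f(Aᵢ)` form a grading of `B`, and taking homogeneous components commutes with `f`.
(For `f` the quotient map by a homogeneous ideal this is the grading of `A ⧸ I`.) [folklore] -/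
theorem exists_gradedRing_map [GradedRing 𝒜] (hf : Function.Surjective f)
    (hker : (RingHom.ker f).IsHomogeneous 𝒜) :
    ∃ _ : GradedRing fun i => (𝒜 i).map f.toAddMonoidHom,
      ∀ (a : A) (i : ι),
        (decompose (fun i => (𝒜 i).map f.toAddMonoidHom) (f a) i : B) = f (decompose 𝒜 a i) := by
  classical
  -- the summation map of the image pieces is bijective
  have hinj :
      Function.Injective (DirectSum.coeAddMonoidHom fun i => (𝒜 i).map f.toAddMonoidHom) := by
    rw [injective_iff_map_eq_zero]
    intro x hx
    -- lift `x` componentwise to `⨁ 𝒜 i`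
    have hlift : ∀ i, ∃ a : 𝒜 i, f a = x i := fun i => by
      obtain ⟨a, ha, e⟩ := (x i).2
      exact ⟨⟨a, ha⟩, e⟩
    choose g hg using hlift
    let y : ⨁ i, 𝒜 i := DFinsupp.mk x.support fun i => g i
    have hy : mapPieces 𝒜 f y = x := by
      refine DFinsupp.ext fun i => Subtype.ext ?_
      simp only [mapPieces, DirectSum.map_apply, AddMonoidHom.coe_mk, ZeroHom.coe_mk, y,
        DFinsupp.mk_apply]
      split_ifs with hi
      · exact hg i
      · rw [DFinsupp.notMem_support_iff.1 hi]; simp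
    have hfy : f (DirectSum.coeAddMonoidHom 𝒜 y) = 0 := by
      rw [← coeAddMonoidHom_mapPieces, hy, hx]
    have hcomp : ∀ i, f (y i) = 0 := fun i => by
      have := hker i hfy
      change (decompose 𝒜 ((decompose 𝒜).symm y) i : A) ∈ RingHom.ker f at this
      rwa [Equiv.apply_symm_apply] at this
    rw [← hy]
    refine DFinsupp.ext fun i => ?_
    simp only [mapPieces, DirectSum.map_apply, DirectSum.zero_apply]
    exact Subtype.ext (hcomp i)
  have hsurj :
      Function.Surjective (DirectSum.coeAddMonoidHom fun i => (𝒜 i).map f.toAddMonoidHom) := by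
    intro b
    obtain ⟨a, rfl⟩ := hf b
    refine ⟨mapPieces 𝒜 f (decompose 𝒜 a), ?_⟩
    rw [coeAddMonoidHom_mapPieces]
    change f ((decompose 𝒜).symm (decompose 𝒜 a)) = f a
    rw [Equiv.symm_apply_apply]
  let D : Decomposition fun i => (𝒜 i).map f.toAddMonoidHom :=
    (show DirectSum.IsInternal fun i => (𝒜 i).map f.toAddMonoidHom from
      ⟨hinj, hsurj⟩).chooseDecomposition
  refine ⟨{ (gradedMonoid_map 𝒜 f) with toDecomposition := D }, fun a i => ?_⟩
  -- homogeneous components commute with `f`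
  conv_lhs => rw [← sum_support_decompose 𝒜 a, map_sum]
  rw [decompose_sum_of_mem (fun i => (𝒜 i).map f.toAddMonoidHom) _ (fun j => f (decompose 𝒜 a j))
    fun j _ => AddSubgroup.mem_map_of_mem f.toAddMonoidHom (SetLike.coe_mem _)]
  split_ifs with hi
  · rfl
  · rw [DFinsupp.notMem_support_iff.1 hi, ZeroMemClass.coe_zero, map_zero]

end Image

/-! ## Coarsening the grading along a map of degrees -/

section Coarsen

variable {ι ι' R A : Type*} [DecidableEq ι] [DecidableEq ι'] [AddMonoid ι] [AddMonoid ι']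
  [CommRing R] [Ring A] [Algebra R A] (𝒜 : ι → Submodule R A) [GradedAlgebra 𝒜] (φ : ι →+ ι')

/-- The **coarsened grading** along `φ : ι →+ ι'`: `A_j := ⨆_{φ i = j} Aᵢ`. [folklore] -/
def coarsen (j : ι') : Submodule R A := ⨆ i ∈ {i | φ i = j}, 𝒜 i

omit [DecidableEq ι] [DecidableEq ι'] [GradedAlgebra 𝒜] in
variable {𝒜 φ} in
/-- Each fine piece lies in the coarse piece of its image degree. [folklore] -/
theorem le_coarsen {i : ι} {j : ι'} (h : φ i = j) : 𝒜 i ≤ coarsen 𝒜 φ j :=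
  le_biSup 𝒜 (show i ∈ {i | φ i = j} from h)

omit [DecidableEq ι'] in
/-- The coarse pieces form a graded monoid. [folklore] -/
theorem gradedMonoid_coarsen : SetLike.GradedMonoid (coarsen 𝒜 φ) where
  one_mem := le_coarsen (map_zero φ) (SetLike.one_mem_graded 𝒜)
  mul_mem j j' x y hx hy := by
    have hle : coarsen 𝒜 φ j * coarsen 𝒜 φ j' ≤ coarsen 𝒜 φ (j + j') := by
      rw [coarsen, coarsen, Submodule.iSup_mul]
      refine iSup_le fun i => ?_
      rw [Submodule.iSup_mul]
      refine iSup_le fun hi => ?_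
      rw [Submodule.mul_iSup]
      refine iSup_le fun i' => ?_
      rw [Submodule.mul_iSup]
      refine iSup_le fun hi' => Submodule.mul_le.2 fun m hm n hn => ?_
      have hii' : φ (i + i') = j + j' := by
        rw [map_add, show φ i = j from hi, show φ i' = j' from hi']
      exact le_coarsen hii' (SetLike.mul_mem_graded hm hn)
    exact hle (Submodule.mul_mem_mul hx hy)

omit [DecidableEq ι'] in
/-- The coarse pieces span. [folklore] -/
theorem iSup_coarsen_eq_top : ⨆ j, coarsen 𝒜 φ j = ⊤ := by
  rw [eq_top_iff, ← (Decomposition.isInternal 𝒜).submodule_iSup_eq_top]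
  exact iSup_le fun i => (le_coarsen (𝒜 := 𝒜) (φ := φ) rfl).trans (le_iSup (coarsen 𝒜 φ) (φ i))

omit [DecidableEq ι'] in
/-- The coarse pieces are independent (the fibres of `φ` are disjoint). [folklore] -/
theorem iSupIndep_coarsen : iSupIndep (coarsen 𝒜 φ) := by
  intro j
  have h2 : (⨆ j' ≠ j, coarsen 𝒜 φ j') ≤ ⨆ i ∈ {i | φ i ≠ j}, 𝒜 i :=
    iSup₂_le fun j' hj' => iSup₂_le fun i hi =>
      le_biSup 𝒜 (show i ∈ {i | φ i ≠ j} from fun h => hj' (hi.symm.trans h))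
  refine Disjoint.mono_right h2 ?_
  exact (Decomposition.isInternal 𝒜).submodule_iSupIndep.disjoint_biSup_biSup
    (Set.disjoint_left.2 fun i (h1 : φ i = j) (h2 : φ i ≠ j) => h2 h1)

/-- **The coarsened grading** along an additive map of degrees `φ : ι →+ ι'` is a grading.
[folklore] -/
theorem nonempty_gradedAlgebra_coarsen : Nonempty (GradedAlgebra (coarsen 𝒜 φ)) :=
  have hint : DirectSum.IsInternal (coarsen 𝒜 φ) :=
    (DirectSum.isInternal_submodule_iff_iSupIndep_and_iSup_eq_top _).2
      ⟨iSupIndep_coarsen 𝒜 φ, iSup_coarsen_eq_top 𝒜 φ⟩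
  ⟨{ (gradedMonoid_coarsen 𝒜 φ) with toDecomposition := hint.chooseDecomposition }⟩

end Coarsen

/-! ## Inverses of homogeneous units -/

section Units

variable {ι A σ : Type*} [DecidableEq ι] [AddGroup ι] [Ring A] [SetLike σ A]
  [AddSubmonoidClass σ A] (𝒜 : ι → σ) [GradedRing 𝒜]

/-- In a ring graded by a group, **the inverse of a homogeneous unit of degree `i` is homogeneous
of degree `-i`**: if `u w = w u = 1` then the degree-`0` component of `u w` is `u w₋ᵢ`, so the
component `w₋ᵢ` is already an inverse. [folklore] -/
theorem exists_inv_mem_of_isUnit {u : A} {i : ι} (hu : u ∈ 𝒜 i) (h : IsUnit u) :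
    ∃ w ∈ 𝒜 (-i), u * w = 1 ∧ w * u = 1 := by
  obtain ⟨v, rfl⟩ := h
  refine ⟨decompose 𝒜 (↑v⁻¹ : A) (-i), SetLike.coe_mem _, ?_, ?_⟩
  · have key := coe_decompose_mul_add_of_left_mem 𝒜 (j := -i) (b := (↑v⁻¹ : A)) hu
    rw [Units.mul_inv, show (decompose 𝒜 (1 : A) (i + -i) : A) = decompose 𝒜 (1 : A) 0 by
      rw [add_neg_cancel], decompose_of_mem_same 𝒜 (SetLike.one_mem_graded 𝒜)] at key
    exact key.symm
  · have key := coe_decompose_mul_add_of_right_mem 𝒜 (i := -i) (a := (↑v⁻¹ : A)) hu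
    rw [Units.inv_mul, show (decompose 𝒜 (1 : A) (-i + i) : A) = decompose 𝒜 (1 : A) 0 by
      rw [neg_add_cancel], decompose_of_mem_same 𝒜 (SetLike.one_mem_graded 𝒜)] at key
    exact key.symm

end Units

end Summit.ResolutionOfSingularities.ResolutionOfSingularities.Theorems.DatumToEmbedded.QuotientSingularities
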